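import Mathlib
import HarnessLib.Audit
import Summits.PneNP.PneNP.Theorems.PstarCrossCasePUnitBlind
import Summits.PneNP.PneNP.Theorems.PstarCrossCasePStructure
import Summits.PneNP.PneNP.Theorems.PstarCrossBudgetCarriers

/-!
# The blind free CROSS gate, regime P (node N2): a single UNIT chord is impossible — N2 is reduced to the all-(NOR) row (O2 / E1; prover-1 g23)

FRONTIER range-avoidance ladder, rung F-N3 (`stmt-PneNP-19007`), cell `pnp-ideate`; restricted-model proof complexity — nothing here bears on `P` versus `NP`.

Node N2 (`PstarCrossNodes.CrossCasePChords`).  By `PstarCrossCasePStructure.caseP_dichotomy` the real chords are a single UNIT, or all (NOR), unless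
`#J₀ ≤ 5`.  A single unit `e` (`D e = {j₁, j₂}`, literals `σ ∈ j₁`, `τ ∈ j₂`, polar formula) dies by the budget:

* every private tree edge lies in `{j₁, j₂}` (`PstarCrossCasePUnitBlind.unit_privEdge_mem_D`);
* the polar formula makes `{σ, τ}` the AND pair of a tree edge of `T₂` or of a private-free monomial of `G₂` (`polarDir_single`, `polar_basis`):
  a tree edge un-privatises both `j₁` and `j₂` (no private edge left: `cross_budget` gives `#(J₀ ∖ N) = 0`), a monomial is a CARRIER on `j₁ × j₂`
  (`cross_budget_carriers` gives `#(J₀ ∖ N) ≤ 1`) — but `#(J₀ ∖ N) ≥ #D e = 2`.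
* **`caseP_single_unit_false`**, and the reduction **`crossCaseP_reduction`**: regime P with a real chord has `#J₀ ≤ 5`, or `q_{(1,0)}` is in NOR form and
  every real chord is (NOR) (neither (EQ) nor a unit).  The all-(NOR) row is what remains of N2.
-/

set_option linter.dupNamespace false -- `Summit.PneNP.PneNP.…`: summit = sub-problem name (D-0017 single-conjunct layout)

open Finset Module Literature.Computability.Complexity
open Summit.PneNP.PneNP.Theorems.PstarTyped (Typed)
open Summit.PneNP.PneNP.Theorems.PstarSALevel (varSet BoundaryExpanding SimpleOverlap)
open Summit.PneNP.PneNP.Theorems.PstarCentreFree (vars_mem_varSet)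
open Summit.PneNP.PneNP.Theorems.PstarGapLinearised (andPair)
open Summit.PneNP.PneNP.Theorems.PstarChordEndgameTools (mem_andPair_iff)
open Summit.PneNP.PneNP.Theorems.PstarCubeIdeals (IsAffineFn)
open Summit.PneNP.PneNP.Theorems.PstarProductRank (qform polar)
open Summit.PneNP.PneNP.Theorems.PstarPathRank (AndAdj polar_basis and_ne)
open Summit.PneNP.PneNP.Theorems.PstarReadSumset (V2)
open Summit.PneNP.PneNP.Theorems.PstarChordSystem (ChordSystem)
open Summit.PneNP.PneNP.Theorems.PstarChordBridgeTools
open Summit.PneNP.PneNP.Theorems.PstarChordBridge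
open Summit.PneNP.PneNP.Theorems.PstarChordBridgeForcing (freeMon gam)
open Summit.PneNP.PneNP.Theorems.PstarChordBridgeBasis (qDir polarDir)
open Summit.PneNP.PneNP.Theorems.PstarGateCasePUnitsTouch (polarDir_single)
open Summit.PneNP.PneNP.Theorems.PstarCrossData (CrossData)
open Summit.PneNP.PneNP.Theorems.PstarCrossSystem
open Summit.PneNP.PneNP.Theorems.PstarCrossCorner (PrivEdge)
open Summit.PneNP.PneNP.Theorems.PstarCrossBudget (cross_budget)
open Summit.PneNP.PneNP.Theorems.PstarCrossBudgetCarriers (cross_budget_carriers)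
open Summit.PneNP.PneNP.Theorems.PstarCrossCasePUnitBlind (unit_privEdge_mem_D)
open Summit.PneNP.PneNP.Theorems.PstarCrossCasePStructure (caseP_dichotomy)

namespace Summit.PneNP.PneNP.Theorems.PstarCrossCasePUnit

variable {n m : ℕ}

section

variable (I : LocalMap 4 n m) {r : ℕ} {B : BridgeData n m} {e_p e_q g₀ : Fin m}

/-- **A single unit chord is impossible.**  See the module docstring. -/
theorem caseP_single_unit_false (hI : I.IsPure xorAndPred) (hT : Typed I) (hS : SimpleOverlap I) (hB : BoundaryExpanding r I)
    (hD : CrossData I r B e_p e_q g₀) (hSR : ((sys I B).vsys e_p e_q).SingleRead) {e : Fin m} (hE : (B.N.erase e_q).erase e_p = {e})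
    {ν₁ ν₂ : (Fin n → ZMod 2) → ZMod 2} (hν₁ : IsAffineFn ν₁) (hν₂ : IsAffineFn ν₂) {κ : ZMod 2}
    (hEXC : ∀ x, qform (B.D e) (fun j => I.vars j 2) (fun j => I.vars j 3) x = qDir I B (1, 0) x + ν₁ x * ν₂ x + κ)
    {j₁ j₂ : Fin m} {σ τ : Fin n} (hj : j₁ ≠ j₂) (hDe : B.D e = {j₁, j₂}) (hdisj : Disjoint (andPair I j₁) (andPair I j₂))
    (hσ : σ ∈ andPair I j₁) (hτ : τ ∈ andPair I j₂)
    (hsupp : ∀ v : Fin n, (ν₁ (Pi.single v 1) ≠ ν₁ 0 ∨ ν₂ (Pi.single v 1) ≠ ν₂ 0) ↔ (v = σ ∨ v = τ))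
    (hpol : ∀ v w : Fin n, polarDir I B (1, 0) (Pi.single v 1) (Pi.single w 1) =
      (if AndAdj I (B.D e) v w then 1 else 0) + (if (v = σ ∧ w = τ) ∨ (v = τ ∧ w = σ) then 1 else 0)) : False := by
  classical
  have hW := hD.wf
  have he' : e ∈ (B.N.erase e_q).erase e_p := by rw [hE]; exact mem_singleton_self _
  have heN : e ∈ B.N := mem_of_mem_erase (mem_of_mem_erase he')
  have hDT : B.D e ⊆ B.J₀ \ B.N := hW.hD e heN
  have hj₁T : j₁ ∈ B.J₀ \ B.N := hDT (by rw [hDe]; exact mem_insert_self _ _)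
  have hj₂T : j₂ ∈ B.J₀ \ B.N := hDT (by rw [hDe]; exact mem_insert_of_mem (mem_singleton_self _))
  have hj₁J : j₁ ∈ B.J₀ := (mem_sdiff.1 hj₁T).1
  have hj₂J : j₂ ∈ B.J₀ := (mem_sdiff.1 hj₂T).1
  -- `#N = 3`, `#(J₀ ∖ N) ≥ 2`
  have hN : B.N = insert e_q (insert e_p {e}) := by
    rw [← insert_erase hD.mem_q, ← insert_erase (mem_erase.2 ⟨hD.ne, hD.mem_p⟩ : e_p ∈ B.N.erase e_q), hE]
  have hN3 : B.N.card = 3 := by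
    rw [hN, card_insert_of_notMem, card_insert_of_notMem, card_singleton]
    · exact fun h => (ne_of_mem_erase he').symm (mem_singleton.1 h)
    · rw [mem_insert, mem_singleton]; push Not
      exact ⟨hD.ne.symm, fun h => (ne_of_mem_erase (mem_of_mem_erase he')).symm h⟩
  have hT2 : 2 ≤ (B.J₀ \ B.N).card := by
    have h2 : (B.D e).card = 2 := by rw [hDe, card_pair hj]
    exact h2 ▸ card_le_card hDT
  -- every private tree edge is `j₁` or `j₂`
  have hmemD : ∀ π, PrivEdge I B π → π = j₁ ∨ π = j₂ := fun π hπ => by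
    have h := unit_privEdge_mem_D I hI hT hS hD hSR he' hν₁ hν₂ hEXC hDe hdisj hσ hτ hsupp hpol hπ
    rw [hDe, mem_insert, mem_singleton] at h
    exact h
  -- `σ`, `τ` as slots
  have hσv : σ ∈ varSet I j₁ := by
    rcases (mem_andPair_iff I j₁ σ).1 hσ with h | h <;> rw [h]
    exacts [vars_mem_varSet I j₁ 2, vars_mem_varSet I j₁ 3]
  have hτv : τ ∈ varSet I j₂ := by
    rcases (mem_andPair_iff I j₂ τ).1 hτ with h | h <;> rw [h]
    exacts [vars_mem_varSet I j₂ 2, vars_mem_varSet I j₂ 3]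
  have hpriv_σ : ∀ {o : Fin m}, σ ∈ varSet I o → o ≠ j₁ → ¬ (I.vars j₁ 2 ∉ varSet I o ∧ I.vars j₁ 3 ∉ varSet I o) := by
    intro o hσo hoj h
    rcases (mem_andPair_iff I j₁ σ).1 hσ with e1 | e1
    · exact h.1 (e1 ▸ hσo)
    · exact h.2 (e1 ▸ hσo)
  have hpriv_τ : ∀ {o : Fin m}, τ ∈ varSet I o → o ≠ j₂ → ¬ (I.vars j₂ 2 ∉ varSet I o ∧ I.vars j₂ 3 ∉ varSet I o) := by
    intro o hτo hoj h
    rcases (mem_andPair_iff I j₂ τ).1 hτ with e1 | e1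
    · exact h.1 (e1 ▸ hτo)
    · exact h.2 (e1 ▸ hτo)
  -- the gadget `{σ, τ}` is an AND pair of `T₂` or of a private-free monomial of `G₂`
  have hστ : ¬ AndAdj I (B.D e) σ τ := by
    rintro ⟨j, hjD, hvw⟩
    rw [hDe, mem_insert, mem_singleton] at hjD
    rcases hjD with hj1 | hj2
    · rw [hj1] at hvw
      have : τ ∈ andPair I j₁ := by
        rcases hvw with ⟨-, h⟩ | ⟨h, -⟩
        · exact (mem_andPair_iff I _ _).2 (Or.inr h.symm)
        · exact (mem_andPair_iff I _ _).2 (Or.inl h.symm)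
      exact Finset.disjoint_left.1 hdisj this hτ
    · rw [hj2] at hvw
      have : σ ∈ andPair I j₂ := by
        rcases hvw with ⟨h, -⟩ | ⟨-, h⟩
        · exact (mem_andPair_iff I _ _).2 (Or.inl h.symm)
        · exact (mem_andPair_iff I _ _).2 (Or.inr h.symm)
      exact Finset.disjoint_left.1 hdisj hσ this
  have hgad : (if AndAdj I B.T₂ σ τ then (1 : ZMod 2) else 0) + (if AndAdj I (freeMon I B.N B.G₂) σ τ then 1 else 0) = 1 := by
    have h := hpol σ τ
    rw [if_neg hστ, if_pos (Or.inl ⟨rfl, rfl⟩), zero_add, polarDir_single] at h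
    simp only [zero_mul, one_mul, zero_add, LinearMap.add_apply] at h
    rw [polar_basis I hI hS, polar_basis I hI hS] at h
    exact h
  by_cases hT₂ : AndAdj I B.T₂ σ τ
  · -- a tree edge `t` with AND pair `{σ, τ}`: neither `j₁` nor `j₂` is private, so no private edge at all
    obtain ⟨t, ht, hvw⟩ := hT₂
    have htJ : t ∈ B.J₀ := (mem_sdiff.1 (hW.hT₂ ht)).1
    have hσt : σ ∈ varSet I t := by
      rcases hvw with ⟨h, -⟩ | ⟨-, h⟩ <;> rw [← h]
      exacts [vars_mem_varSet I t 2, vars_mem_varSet I t 3]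
    have hτt : τ ∈ varSet I t := by
      rcases hvw with ⟨-, h⟩ | ⟨h, -⟩ <;> rw [← h]
      exacts [vars_mem_varSet I t 3, vars_mem_varSet I t 2]
    have hτt' : τ ∈ andPair I t := by
      rcases hvw with ⟨-, h⟩ | ⟨h, -⟩
      · exact (mem_andPair_iff I _ _).2 (Or.inr h.symm)
      · exact (mem_andPair_iff I _ _).2 (Or.inl h.symm)
    have hσt' : σ ∈ andPair I t := by
      rcases hvw with ⟨h, -⟩ | ⟨-, h⟩
      · exact (mem_andPair_iff I _ _).2 (Or.inl h.symm)
      · exact (mem_andPair_iff I _ _).2 (Or.inr h.symm)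
    have htj₁ : t ≠ j₁ := fun h => Finset.disjoint_left.1 hdisj (h ▸ hτt') hτ
    have htj₂ : t ≠ j₂ := fun h => Finset.disjoint_left.1 hdisj hσ (h ▸ hσt')
    have hno : ∀ π, ¬ PrivEdge I B π := fun π hπ => by
      rcases hmemD π hπ with h | h
      · rw [h] at hπ; exact hpriv_σ hσt htj₁ (hπ.2 t htJ htj₁)
      · rw [h] at hπ; exact hpriv_τ hτt htj₂ (hπ.2 t htJ htj₂)
    obtain ⟨Pv, hPvT, hpriv, hcount⟩ := cross_budget I hB hD
    have hPv0 : Pv = ∅ := eq_empty_of_forall_notMem fun π hπ =>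
      hno π ⟨hPvT hπ, fun j hj hne => hpriv π hπ j (mem_insert_of_mem hj) hne⟩
    rw [hPv0, card_empty, hN3] at hcount
    omega
  · -- a private-free monomial `o` of `G₂` with AND pair `{σ, τ}`: a carrier on `j₁ × j₂`
    rw [if_neg hT₂, zero_add] at hgad
    have hG₂ : AndAdj I (freeMon I B.N B.G₂) σ τ := by
      by_contra h; rw [if_neg h] at hgad; exact zero_ne_one hgad
    obtain ⟨o, ho, hvw⟩ := hG₂
    have hoG : o ∈ B.G₂ := (mem_filter.1 ho).1
    have hoJ : o ∉ B.J₀ := fun h => Finset.disjoint_left.1 hD.disj₂ hoG h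
    have hσo : σ ∈ varSet I o := by
      rcases hvw with ⟨h, -⟩ | ⟨-, h⟩ <;> rw [← h]
      exacts [vars_mem_varSet I o 2, vars_mem_varSet I o 3]
    have hτo : τ ∈ varSet I o := by
      rcases hvw with ⟨-, h⟩ | ⟨h, -⟩ <;> rw [← h]
      exacts [vars_mem_varSet I o 3, vars_mem_varSet I o 2]
    have hog₀ : g₀ ∉ ({o} : Finset (Fin m)) := by
      rw [mem_singleton]
      intro h
      rw [← h] at hoG
      exact ((hD.hun _ (vars_mem_privs I hD.mem_p (s := 2) (by decide))).2 g₀ hoG).1 hD.gate_vars.1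
    have hold : ∀ o' ∈ ({o} : Finset (Fin m)), (∃ j ∈ B.J₀, I.vars o' 2 ∈ varSet I j) ∧ (∃ j ∈ B.J₀, I.vars o' 3 ∈ varSet I j) := by
      intro o' ho'
      rw [mem_singleton] at ho'
      subst ho'
      rcases hvw with ⟨h2, h3⟩ | ⟨h2, h3⟩
      · exact ⟨⟨j₁, hj₁J, h2 ▸ hσv⟩, ⟨j₂, hj₂J, h3 ▸ hτv⟩⟩
      · exact ⟨⟨j₂, hj₂J, h2 ▸ hτv⟩, ⟨j₁, hj₁J, h3 ▸ hσv⟩⟩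
    obtain ⟨Pv, hPvT, hpriv, hcount⟩ := cross_budget_carriers I hB hD (O := {o})
      (singleton_subset_iff.2 (mem_union_right _ hoG)) (disjoint_singleton_left.2 hoJ) hog₀ hold
    have hoX : o ∈ ({o} : Finset (Fin m)) ∪ insert g₀ B.J₀ := mem_union_left _ (mem_singleton_self o)
    have hPv0 : Pv = ∅ := by
      refine eq_empty_of_forall_notMem fun π hπ => ?_
      have hπE : PrivEdge I B π := ⟨hPvT hπ, fun j hj hne => hpriv π hπ j (mem_union_right _ (mem_insert_of_mem hj)) hne⟩
      have hoπ : o ≠ π := fun h => hoJ (h ▸ (mem_sdiff.1 (hPvT hπ)).1)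
      have hp := hpriv π hπ o hoX hoπ
      rcases hmemD π hπE with h | h
      · rw [h] at hp; exact hpriv_σ hσo (fun h' => hoJ (h' ▸ hj₁J)) hp
      · rw [h] at hp; exact hpriv_τ hτo (fun h' => hoJ (h' ▸ hj₂J)) hp
    rw [hPv0, card_empty, card_singleton, hN3] at hcount
    omega

end

/-- **N2 reduced to the all-(NOR) row.**  In regime P with a real chord: `#J₀ ≤ 5`, or `q_{(1,0)}` is in NOR form and every real chord is (NOR) — neither
(EQ) nor a unit — w.r.t. `q_{(1,0)}`. -/
theorem crossCaseP_reduction (I : LocalMap 4 n m) {r : ℕ} {B : BridgeData n m} {e_p e_q g₀ : Fin m}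
    (hI : I.IsPure xorAndPred) (hT : Typed I) (hS : SimpleOverlap I) (hB : BoundaryExpanding r I)
    (hD : CrossData I r B e_p e_q g₀) (hne : ((B.N.erase e_q).erase e_p).Nonempty) (hSR : ((sys I B).vsys e_p e_q).SingleRead) :
    B.J₀.card ≤ 5 ∨
    ((∃ a b : Fin n → ZMod 2, ∃ β α : ZMod 2, ∀ x, qDir I B (1, 0) x = (polarDir I B (1, 0) x b + β) * (polarDir I B (1, 0) x a + α) + 1) ∧
      ∀ e ∈ (B.N.erase e_q).erase e_p,
        (¬ ∃ κ : ZMod 2, ∀ x, qform (B.D e) (fun j => I.vars j 2) (fun j => I.vars j 3) x = qDir I B (1, 0) x + κ) ∧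
        ¬ (∃ j₁ j₂ : Fin m, ∃ σ τ : Fin n, j₁ ≠ j₂ ∧ B.D e = {j₁, j₂} ∧ Disjoint (andPair I j₁) (andPair I j₂) ∧ σ ∈ andPair I j₁ ∧ τ ∈ andPair I j₂ ∧
          ∀ v w : Fin n, polarDir I B (1, 0) (Pi.single v 1) (Pi.single w 1) =
            (if AndAdj I (B.D e) v w then 1 else 0) + (if (v = σ ∧ w = τ) ∨ (v = τ ∧ w = σ) then 1 else 0))) := by
  rcases caseP_dichotomy I hI hT hS hB hD hSR with h | ⟨e, hE, ν₁, ν₂, hν₁, hν₂, ⟨κ, hEXC⟩, j₁, j₂, σ, τ, hj, hDe, hdisj, hσ, hτ, hsupp, hpol⟩ | h | h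
  · exact Or.inl h
  · exact (caseP_single_unit_false I hI hT hS hB hD hSR hE hν₁ hν₂ hEXC hj hDe hdisj hσ hτ hsupp hpol).elim
  · exact Or.inr h
  · exact absurd h (nonempty_iff_ne_empty.1 hne)

end Summit.PneNP.PneNP.Theorems.PstarCrossCasePUnit
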